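import Summits.CriticalPhenomena.PercolationContinuityZ3.Theorems.PercNearOneGluingNoHeavyLowerTailSahiLatinZeroBottomHalfCore

/-!
# `NoHeavyLowerTail` (crux stmt-CriticalPhenomena-4575), Sahi programme (prim-master-conj gen 52): **THE TWO ONE-BLOCK LEMMAS (Jβ), (Jγ)
# FOR EVERY BLOCK `U`** — the hypotheses of the half-core reduction `grid4_halfCore` hold for EVERY nested pair of up-sets

Support file (`--supports stmt-CriticalPhenomena-4575`; small definitions (abstract point types, the two certificate integrands) + proofs,
no `sorry`, standard axioms).  Memo `run/shared/lean/prim/prim-l12/FROM-prim-master-conj-g52-ONE-BLOCK.md`.  Nothing here asserts the crux,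
Kahn's conjecture or (C¼).

THE MATHEMATICS.  `…ZeroBottomHalfCore` (gen 51) reduced the grid invariant of every HALF-CORE instance (`P = S × Ω`, `b = B × Ω` for a nested
pair of up-sets `S ⊆ S′ = S ⊔ B` of `[3]^U`; `Q = Ω × T`, `c = Ω × Tᶜ`) to a `HalfCoreCert S B L₁ L₂ M₁ M₂`, i.e. to the two ONE-BLOCK
inequalities (with `X = 2^{|U|}`, `N(J;A) = Σ_{w∈J} N_A(w)` the number of Latin pairs from `J` into `A`, all `H`, `J` up-sets):
  (Jβ)  `4N(H₁;B) + N(H₂;S) ≤ 2X|B| + 2X|H₁∩B| + X|S| + 3N(H₂;B) + X|H₂∩B|`                                  (`H₁ ⊇ S`),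
  (Jγ)  `4N(H₁;B) + 2N(J_OS;S) + 4N(J_SO∩J_OS;B) ≤ X|B| + 2X|S| + 3X|H₁∩B| + 4X|(J_SO∪J_OS)∩B| + 2X|J_SO∩B| + 6N(J_OS;B)`   (`H₁, J_SO ⊇ S`),
which were known only by exhaustive computation for `|U| ≤ 3`.  THIS FILE PROVES BOTH FOR EVERY `U` (`oneBlock_beta`, `oneBlock_gamma`).
PROOF (new method: LATIN-TRIPLE SYMMETRISATION + CONDITIONAL HARRIS GIVEN THE THIRD POINT).  Every quantity is a sum over the `6^{|U|}` Latin
triples `(x,y,z)` (`X|A| = #{(x,y,z) : y ∈ A}`, `N(J;A) = #{(x,y,z) : x ∈ J, y ∈ A}`), so each inequality reads `0 ≤ Σ_{(x,y,z)} g(x,y)` for an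
explicit integer integrand `g` of the membership bits of `x, y`.  Two facts about such sums: (i) they are invariant under permuting the three
points (`sum_lpt_perm`), so `6·Σ g = Σ (g summed over the six orderings)` (`six_mul_sum_lperm`); (ii) CONDITIONAL HARRIS: for up-sets `K, L`
and ANY weight `μ ≥ 0` on the third point, `Σ μ(z)[x∈K][y∈L] ≤ Σ μ(z)[x∈K∩L]` (`sum_lperm_condHarris`) — given `z`, `(x,y)` is an antipodal
pair of the cube `link z`, and this is the antipodal Harris inequality `Λ_{K,L}(z) ≤ N_{K∩L}(z)` of `…SahiLatinMoves` (`Lam_le_N`).  An exact LP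
over the `220` (resp. `2 300`) triple types found nonnegative integer combinations of FOUR (resp. NINE) conditional-Harris terms whose
difference from `g` is, after six-fold symmetrisation, POINTWISE nonnegative on every triple — a finite check on membership bits that the
kernel performs by `decide` (`fB6_nonneg`, `fG6_nonneg`).  The certificates:
  (Jβ):  `[z ∈ H₁∖(S′∪H₂)]·{(S′,H₁) + (S′,H₁∪H₂)} + [z ∈ S∖H₂]·{(S′,H₁∪(S′∩H₂)) + (H₁,S′∪H₂)}`,
  (Jγ):  `2[z ∈ ∅-type]·(S′,H₁) + 2[z ∈ B only]·(S′,H₁) + 2[z ∈ S∩H₁∩J_SO∖J_OS]·(S′,H₁) + 2[z ∈ H₁ only]·(S′,H₁∪J_SO) + 2[z ∈ H₁∩J_SO only]·(S′,H₁∪J_SO)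
         + [z ∈ H₁ only]·(S′,H₁∪J_OS) + [z ∈ H₁∩J_SO only]·(S′,H₁∪J_OS) + [z ∈ H₁∩J_SO∩J_OS∖S′]·(S′,H₁∪J_OS) + 2[z ∈ B∩H₁∖(J_SO∪J_OS)]·(S′∪J_OS, H₁∪J_OS)`
(`(K,L)` = the conditional-Harris term for `K, L`).  Consequence (companion file `…ZeroBottomHalfCoreAll`): a `HalfCoreCert` for EVERY
disjoint `(S, B)` with `S ∪ B` an up-set, hence `Grid4` on every half-core instance and TOP₁(3/2) on the whole half-core family. [this work]
-/

namespace Summit.CriticalPhenomena.PercolationContinuityZ3.Theorems.SahiLatin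

open Finset

/-! ## §1  Abstract point types and the two pointwise certificates (finite checks) -/

namespace OneBlock

/-- `Bool ↦ {0,1} ⊆ ℤ`. [this work] -/
def bi (b : Bool) : ℤ := if b then 1 else 0

/-- `bi` is multiplicative on `&&`. [this work] -/
theorem bi_and (a b : Bool) : bi (a && b) = bi a * bi b := by cases a <;> cases b <;> rfl

/-- Abstract membership type for (Jβ): bits `(x∈S, x∈B, x∈H₁, x∈H₂)`. [this work] -/
abbrev TyB := Bool × Bool × Bool × Bool

/-- Admissible (Jβ)-types: `S ∩ B = ∅`, `S ⊆ H₁`. [this work] -/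
def admB (t : TyB) : Bool := !(t.1 && t.2.1) && (!t.1 || t.2.2.1)

/-- The (Jβ) integrand `g(x,y) = 2[y∈B] + 2[y∈H₁][y∈B] + [y∈S] + 3[x∈H₂][y∈B] + [y∈H₂][y∈B] − 4[x∈H₁][y∈B] − [x∈H₂][y∈S]`. [this work] -/
def gB (x y : TyB) : ℤ :=
  2 * bi y.2.1 + 2 * (bi y.2.2.1 * bi y.2.1) + bi y.1 + 3 * (bi x.2.2.2 * bi y.2.1) + bi y.2.2.2 * bi y.2.1
    - 4 * (bi x.2.2.1 * bi y.2.1) - bi x.2.2.2 * bi y.1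

/-- A conditional-Harris term `μ(z)·([x∈K][x∈L] − [x∈K][y∈L])` on abstract types. [this work] -/
def chT {α : Type} (iK iL μ : α → ℤ) (x y z : α) : ℤ := μ z * (iK x * iL x - iK x * iL y)

/-- `[t ∈ S′] = [t ∈ S ∪ B]`. [this work] -/
def iSp (t : TyB) : ℤ := bi (t.1 || t.2.1)
/-- `[t ∈ H₁]`. [this work] -/
def iH1 (t : TyB) : ℤ := bi t.2.2.1
/-- `[t ∈ H₁ ∪ H₂]`. [this work] -/
def iH1H2 (t : TyB) : ℤ := bi (t.2.2.1 || t.2.2.2)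
/-- `[t ∈ H₁ ∪ (S′ ∩ H₂)]`. [this work] -/
def iH1SpH2 (t : TyB) : ℤ := bi (t.2.2.1 || ((t.1 || t.2.1) && t.2.2.2))
/-- `[t ∈ S′ ∪ H₂]`. [this work] -/
def iSpH2 (t : TyB) : ℤ := bi ((t.1 || t.2.1) || t.2.2.2)
/-- weight `[z ∈ H₁ ∖ (S′ ∪ H₂)]`. [this work] -/
def m0010 (t : TyB) : ℤ := bi (!t.1 && !t.2.1 && t.2.2.1 && !t.2.2.2)
/-- weight `[z ∈ S ∖ H₂]` (then `z ∈ H₁` automatically). [this work] -/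
def m1110 (t : TyB) : ℤ := bi (t.1 && !t.2.1 && t.2.2.1 && !t.2.2.2)

/-- (Jβ) integrand minus its certificate. [this work] -/
def fB (x y z : TyB) : ℤ :=
  gB x y - chT iSp iH1 m0010 x y z - chT iSp iH1H2 m0010 x y z - chT iSp iH1SpH2 m1110 x y z - chT iH1 iSpH2 m1110 x y z

/-- Its six-fold symmetrisation. [this work] -/
def fB6 (x y z : TyB) : ℤ := fB x y z + fB x z y + fB y x z + fB y z x + fB z x y + fB z y x

set_option maxRecDepth 4000 in
/-- **Pointwise certificate for (Jβ)** (finite check over `10³` admissible type triples). [this work] -/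
theorem fB6_nonneg : ∀ x y z : TyB, admB x = true → admB y = true → admB z = true → 0 ≤ fB6 x y z := by decide

/-- Abstract membership type for (Jγ): bits `(x∈S, x∈B, x∈H₁, x∈J_SO, x∈J_OS)` (`J_OO` is replaced by `J_SO ∩ J_OS`). [this work] -/
abbrev TyG := Bool × Bool × Bool × Bool × Bool

/-- Admissible (Jγ)-types: `S ∩ B = ∅`, `S ⊆ H₁`, `S ⊆ J_SO`. [this work] -/
def admG (t : TyG) : Bool := !(t.1 && t.2.1) && (!t.1 || t.2.2.1) && (!t.1 || t.2.2.2.1)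

/-- The (Jγ) integrand `g(x,y) = [y∈B] + 2[y∈S] + 3[y∈H₁][y∈B] − 4[x∈H₁][y∈B] + 4[y∈J_SO∪J_OS][y∈B] + 2[y∈J_SO][y∈B] + 6[x∈J_OS][y∈B]
− 2[x∈J_OS][y∈S] − 4[x∈J_SO][x∈J_OS][y∈B]`. [this work] -/
def gG (x y : TyG) : ℤ :=
  bi y.2.1 + 2 * bi y.1 + 3 * (bi y.2.2.1 * bi y.2.1) - 4 * (bi x.2.2.1 * bi y.2.1) + 4 * (bi (y.2.2.2.1 || y.2.2.2.2) * bi y.2.1)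
    + 2 * (bi y.2.2.2.1 * bi y.2.1) + 6 * (bi x.2.2.2.2 * bi y.2.1) - 2 * (bi x.2.2.2.2 * bi y.1)
    - 4 * (bi x.2.2.2.1 * bi x.2.2.2.2 * bi y.2.1)

/-- `[t ∈ S′]`. [this work] -/
def jSp (t : TyG) : ℤ := bi (t.1 || t.2.1)
/-- `[t ∈ H₁]`. [this work] -/
def jH1 (t : TyG) : ℤ := bi t.2.2.1
/-- `[t ∈ H₁ ∪ J_SO]`. [this work] -/
def jH1SO (t : TyG) : ℤ := bi (t.2.2.1 || t.2.2.2.1)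
/-- `[t ∈ H₁ ∪ J_OS]`. [this work] -/
def jH1OS (t : TyG) : ℤ := bi (t.2.2.1 || t.2.2.2.2)
/-- `[t ∈ S′ ∪ J_OS]`. [this work] -/
def jSpOS (t : TyG) : ℤ := bi ((t.1 || t.2.1) || t.2.2.2.2)
/-- weight: `z` in none of `S′, H₁, J_SO, J_OS`. [this work] -/
def n00000 (t : TyG) : ℤ := bi (!t.1 && !t.2.1 && !t.2.2.1 && !t.2.2.2.1 && !t.2.2.2.2)
/-- weight: `z ∈ B` only. [this work] -/
def n01000 (t : TyG) : ℤ := bi (!t.1 && t.2.1 && !t.2.2.1 && !t.2.2.2.1 && !t.2.2.2.2)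
/-- weight: `z ∈ S ∩ H₁ ∩ J_SO ∖ J_OS`. [this work] -/
def n10110 (t : TyG) : ℤ := bi (t.1 && !t.2.1 && t.2.2.1 && t.2.2.2.1 && !t.2.2.2.2)
/-- weight: `z ∈ H₁` only. [this work] -/
def n00100 (t : TyG) : ℤ := bi (!t.1 && !t.2.1 && t.2.2.1 && !t.2.2.2.1 && !t.2.2.2.2)
/-- weight: `z ∈ H₁ ∩ J_SO` only. [this work] -/
def n00110 (t : TyG) : ℤ := bi (!t.1 && !t.2.1 && t.2.2.1 && t.2.2.2.1 && !t.2.2.2.2)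
/-- weight: `z ∈ H₁ ∩ J_SO ∩ J_OS ∖ S′`. [this work] -/
def n00111 (t : TyG) : ℤ := bi (!t.1 && !t.2.1 && t.2.2.1 && t.2.2.2.1 && t.2.2.2.2)
/-- weight: `z ∈ B ∩ H₁ ∖ (J_SO ∪ J_OS)`. [this work] -/
def n01100 (t : TyG) : ℤ := bi (!t.1 && t.2.1 && t.2.2.1 && !t.2.2.2.1 && !t.2.2.2.2)

/-- (Jγ) integrand minus its certificate. [this work] -/
def fG (x y z : TyG) : ℤ :=
  gG x y - 2 * chT jSp jH1 n00000 x y z - 2 * chT jSp jH1 n01000 x y z - 2 * chT jSp jH1 n10110 x y z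
    - 2 * chT jSp jH1SO n00100 x y z - 2 * chT jSp jH1SO n00110 x y z
    - chT jSp jH1OS n00100 x y z - chT jSp jH1OS n00110 x y z - chT jSp jH1OS n00111 x y z
    - 2 * chT jSpOS jH1OS n01100 x y z

/-- Its six-fold symmetrisation. [this work] -/
def fG6 (x y z : TyG) : ℤ := fG x y z + fG x z y + fG y x z + fG y z x + fG z x y + fG z y x

set_option maxHeartbeats 400000 in
set_option maxRecDepth 8000 in
/-- **Pointwise certificate for (Jγ)** (finite check over `18³` admissible type triples). [this work] -/
theorem fG6_nonneg : ∀ x y z : TyG, admG x = true → admG y = true → admG z = true → 0 ≤ fG6 x y z := by decide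

end OneBlock

/-! ## §2  Latin-sum toolkit: six-fold symmetrisation and conditional Harris given the third point -/

section latin
variable {ι : Type} [Fintype ι] [DecidableEq ι]

/-- The 3-cycle `0 ↦ 1 ↦ 2 ↦ 0` of `Fin 3`. [this work] -/
def cyc3 : Equiv.Perm (Fin 3) := Equiv.swap 0 2 * Equiv.swap 0 1

/-- The 3-cycle `0 ↦ 2 ↦ 1 ↦ 0` of `Fin 3`. [this work] -/
def cyc3' : Equiv.Perm (Fin 3) := Equiv.swap 0 1 * Equiv.swap 0 2

/-- The transposition `0 ↔ 2` of `Fin 3`. [this work] -/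
def sw02 : Equiv.Perm (Fin 3) := Equiv.swap 0 2

/-- Values of `cyc3` (finite check). [this work] -/
theorem cyc_apply : cyc3 0 = 1 ∧ cyc3 1 = 2 ∧ cyc3 2 = 0 := by decide

/-- Values of `cyc3'` (finite check). [this work] -/
theorem cyc'_apply : cyc3' 0 = 2 ∧ cyc3' 1 = 0 ∧ cyc3' 2 = 1 := by decide

/-- Values of `sw02` (finite check). [this work] -/
theorem swap02_apply : sw02 0 = 2 ∧ sw02 1 = 1 ∧ sw02 2 = 0 := by decide

/-- **Six-fold symmetrisation of a Latin sum**: `6·Σ_ρ F(ρ·0,ρ·1,ρ·2) = Σ_ρ Σ_{orderings} F`. [this work] -/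
theorem six_mul_sum_lperm (F : Pt ι → Pt ι → Pt ι → ℤ) :
    6 * ∑ ρ : LPerm ι, F (lpt ρ 0) (lpt ρ 1) (lpt ρ 2) =
      ∑ ρ : LPerm ι, (F (lpt ρ 0) (lpt ρ 1) (lpt ρ 2) + F (lpt ρ 0) (lpt ρ 2) (lpt ρ 1) + F (lpt ρ 1) (lpt ρ 0) (lpt ρ 2)
        + F (lpt ρ 1) (lpt ρ 2) (lpt ρ 0) + F (lpt ρ 2) (lpt ρ 0) (lpt ρ 1) + F (lpt ρ 2) (lpt ρ 1) (lpt ρ 0)) := by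
  have h1 := sum_lpt_swap12 F
  have h2 := sum_lpt_swap01 F
  have h3 := sum_lpt_perm F cyc3
  rw [cyc_apply.1, cyc_apply.2.1, cyc_apply.2.2] at h3
  have h4 := sum_lpt_perm F cyc3'
  rw [cyc'_apply.1, cyc'_apply.2.1, cyc'_apply.2.2] at h4
  have h5 := sum_lpt_perm F sw02
  rw [swap02_apply.1, swap02_apply.2.1, swap02_apply.2.2] at h5
  rw [sum_add_distrib, sum_add_distrib, sum_add_distrib, sum_add_distrib, sum_add_distrib, h1, h2, h3, h4, h5]
  ring

/-- **Conditional Harris given the third Latin point**: for up-sets `K, L` and any nonnegative weight `μ` on the third point,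
`Σ_ρ μ(ρ·2)[ρ·0 ∈ K][ρ·1 ∈ L] ≤ Σ_ρ μ(ρ·2)[ρ·0 ∈ K ∩ L]` — given `z`, `(x, y)` is an antipodal pair of the cube `link z`, and this is
`Λ_{K,L}(z) ≤ N_{K∩L}(z)` (`Lam_le_N`). [this work] -/
theorem sum_lperm_condHarris {K L : Finset (Pt ι)} (hK : IsUpperSet (K : Set (Pt ι))) (hL : IsUpperSet (L : Set (Pt ι)))
    (μ : Pt ι → ℤ) (hμ : ∀ z, 0 ≤ μ z) :
    ∑ ρ : LPerm ι, μ (lpt ρ 2) * (ind K (lpt ρ 0) * ind L (lpt ρ 1)) ≤ ∑ ρ : LPerm ι, μ (lpt ρ 2) * (ind K (lpt ρ 0) * ind L (lpt ρ 0)) := by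
  have eL : ∑ ρ : LPerm ι, μ (lpt ρ 2) * (ind K (lpt ρ 0) * ind L (lpt ρ 1)) = ∑ x : Pt ι, μ x * (Lam K L x : ℤ) := by
    rw [← sum_lpt_perm (fun x y z => μ z * (ind K x * ind L y)) cyc3, cyc_apply.1,
      cyc_apply.2.1, cyc_apply.2.2, sum_lperm_eq_sum_link (fun x y z => μ x * (ind K y * ind L z))]
    refine sum_congr rfl fun x _ => ?_
    rw [← mul_sum, Lam, natCast_card_filter]
    congr 1
    refine sum_congr rfl fun y _ => ?_
    by_cases hk : y ∈ K <;> by_cases hl : anti x y ∈ L <;> simp [ind, hk, hl]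
  have eR : ∑ ρ : LPerm ι, μ (lpt ρ 2) * (ind K (lpt ρ 0) * ind L (lpt ρ 0)) = ∑ x : Pt ι, μ x * (N (K ∩ L) x : ℤ) := by
    rw [← sum_lpt_perm (fun x _ z => μ z * (ind K x * ind L x)) cyc3, cyc_apply.1,
      cyc_apply.2.2, sum_lperm_eq_sum_link (fun x y _ => μ x * (ind K y * ind L y))]
    refine sum_congr rfl fun x _ => ?_
    rw [← mul_sum, N, natCast_card_filter]
    congr 1
    refine sum_congr rfl fun y _ => ?_
    by_cases hk : y ∈ K <;> by_cases hl : y ∈ L <;> simp [ind, hk, hl]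
  rw [eL, eR]
  exact sum_le_sum fun x _ => mul_le_mul_of_nonneg_left (by exact_mod_cast Lam_le_N hK hL x) (hμ x)

omit [DecidableEq ι] in
/-- Bridge `ind ↔ bi ∘ decide`. [this work] -/
theorem ind_eq_bi (K : Finset (Pt ι)) (x : Pt ι) : ind K x = OneBlock.bi (decide (x ∈ K)) := by
  by_cases h : x ∈ K <;> simp [ind, OneBlock.bi, h]

/-- `Σ_ρ [ρ·1 ∈ A] = 2^d |A|`. [this work] -/
theorem sum_lperm_ind_one (A : Finset (Pt ι)) : ∑ ρ : LPerm ι, ind A (lpt ρ 1) = 2 ^ Fintype.card ι * A.card := by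
  rw [sum_ind_one, S1_eq]

/-- `Σ_ρ [ρ·1 ∈ A][ρ·1 ∈ A'] = 2^d |A ∩ A'|`. [this work] -/
theorem sum_lperm_ind_one_mul (A A' : Finset (Pt ι)) :
    ∑ ρ : LPerm ι, ind A (lpt ρ 1) * ind A' (lpt ρ 1) = 2 ^ Fintype.card ι * (A ∩ A').card := by
  rw [← sum_lperm_ind_one]; exact sum_congr rfl fun ρ _ => by rw [ind_inter]

/-- `Σ_ρ [ρ·0 ∈ J][ρ·1 ∈ A] = N(J;A) = Σ_{w∈J} N_A(w)`. [this work] -/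
theorem sum_lperm_ind_zero_mul_one (J A : Finset (Pt ι)) : ∑ ρ : LPerm ι, ind J (lpt ρ 0) * ind A (lpt ρ 1) = nIn A J := by
  unfold nIn; rw [sum_N_eq_latinPairs]; rfl

end latin

/-! ## §3  (Jβ) for every block -/

section oneblock
variable {U : Type} [Fintype U] [DecidableEq U] (S B : Finset (Pt U))

/-- Membership bits of a point for (Jβ). [this work] -/
def bitsB (H₁ H₂ : Finset (Pt U)) (x : Pt U) : OneBlock.TyB := (decide (x ∈ S), decide (x ∈ B), decide (x ∈ H₁), decide (x ∈ H₂))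

/-- Membership bits of a point for (Jγ). [this work] -/
def bitsG (H₁ JSO JOS : Finset (Pt U)) (x : Pt U) : OneBlock.TyG :=
  (decide (x ∈ S), decide (x ∈ B), decide (x ∈ H₁), decide (x ∈ JSO), decide (x ∈ JOS))

/-- **(Jβ) FOR EVERY BLOCK `U`**: for `S ∩ B = ∅`, `S ∪ B` an up-set, up-sets `H₁ ⊇ S` and `H₂`,
`4N(H₁;B) + N(H₂;S) ≤ 2X|B| + 2X|H₁∩B| + X|S| + 3N(H₂;B) + X|H₂∩B|`. [this work] -/
theorem oneBlock_beta (hSB : Disjoint S B) (hS' : IsUpperSet ((S ∪ B : Finset (Pt U)) : Set (Pt U))) {H₁ H₂ : Finset (Pt U)}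
    (u₁ : IsUpperSet (H₁ : Set (Pt U))) (u₂ : IsUpperSet (H₂ : Set (Pt U))) (hS : S ⊆ H₁) :
    4 * nIn B H₁ + nIn S H₂ ≤ 2 * 2 ^ Fintype.card U * B.card + 2 * 2 ^ Fintype.card U * (H₁ ∩ B).card
      + 2 ^ Fintype.card U * S.card + 3 * nIn B H₂ + 2 ^ Fintype.card U * (H₂ ∩ B).card := by
  -- the target as a Latin sum
  set T : ℤ := ∑ ρ : LPerm U, OneBlock.gB (bitsB S B H₁ H₂ (lpt ρ 0)) (bitsB S B H₁ H₂ (lpt ρ 1)) with hT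
  have eT : T = 2 * 2 ^ Fintype.card U * B.card + 2 * 2 ^ Fintype.card U * (H₁ ∩ B).card + 2 ^ Fintype.card U * S.card
      + 3 * nIn B H₂ + 2 ^ Fintype.card U * (H₂ ∩ B).card - 4 * nIn B H₁ - nIn S H₂ := by
    have h : T = 2 * (∑ ρ : LPerm U, ind B (lpt ρ 1)) + 2 * (∑ ρ : LPerm U, ind H₁ (lpt ρ 1) * ind B (lpt ρ 1))
        + (∑ ρ : LPerm U, ind S (lpt ρ 1)) + 3 * (∑ ρ : LPerm U, ind H₂ (lpt ρ 0) * ind B (lpt ρ 1))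
        + (∑ ρ : LPerm U, ind H₂ (lpt ρ 1) * ind B (lpt ρ 1)) - 4 * (∑ ρ : LPerm U, ind H₁ (lpt ρ 0) * ind B (lpt ρ 1))
        - (∑ ρ : LPerm U, ind H₂ (lpt ρ 0) * ind S (lpt ρ 1)) := by
      rw [hT]
      simp only [mul_sum, ← sum_add_distrib, ← sum_sub_distrib]
      exact sum_congr rfl fun ρ _ => by simp only [OneBlock.gB, bitsB, ind_eq_bi]
    rw [sum_lperm_ind_one, sum_lperm_ind_one_mul, sum_lperm_ind_one, sum_lperm_ind_zero_mul_one, sum_lperm_ind_one_mul,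
      sum_lperm_ind_zero_mul_one, sum_lperm_ind_zero_mul_one] at h
    rw [h]; ring
  -- the four conditional-Harris terms (concrete)
  have up1 : IsUpperSet ((H₁ ∪ H₂ : Finset (Pt U)) : Set (Pt U)) := by rw [coe_union]; exact u₁.union u₂
  have up2 : IsUpperSet ((H₁ ∪ (S ∪ B) ∩ H₂ : Finset (Pt U)) : Set (Pt U)) := by
    rw [coe_union, coe_inter]; exact u₁.union (hS'.inter u₂)
  have up3 : IsUpperSet (((S ∪ B) ∪ H₂ : Finset (Pt U)) : Set (Pt U)) := by rw [coe_union]; exact hS'.union u₂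
  have hμ1 : ∀ z, 0 ≤ OneBlock.m0010 (bitsB S B H₁ H₂ z) := fun z => by unfold OneBlock.m0010 OneBlock.bi; split_ifs <;> norm_num
  have hμ2 : ∀ z, 0 ≤ OneBlock.m1110 (bitsB S B H₁ H₂ z) := fun z => by unfold OneBlock.m1110 OneBlock.bi; split_ifs <;> norm_num
  have c1 := sum_lperm_condHarris hS' u₁ _ hμ1
  have c2 := sum_lperm_condHarris hS' up1 _ hμ1
  have c3 := sum_lperm_condHarris hS' up2 _ hμ2
  have c4 := sum_lperm_condHarris u₁ up3 _ hμ2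
  -- admissibility of the membership bits
  have adm : ∀ x, OneBlock.admB (bitsB S B H₁ H₂ x) = true := by
    intro x
    by_cases hxS : x ∈ S
    · have hxB : x ∉ B := disjoint_left.1 hSB hxS
      have hx1 : x ∈ H₁ := hS hxS
      simp [OneBlock.admB, bitsB, hxS, hxB, hx1]
    · simp [OneBlock.admB, bitsB, hxS]
  -- the symmetrised sum is pointwise nonnegative
  have key : 0 ≤ 6 * ∑ ρ : LPerm U, OneBlock.fB (bitsB S B H₁ H₂ (lpt ρ 0)) (bitsB S B H₁ H₂ (lpt ρ 1)) (bitsB S B H₁ H₂ (lpt ρ 2)) := by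
    rw [six_mul_sum_lperm (fun x y z => OneBlock.fB (bitsB S B H₁ H₂ x) (bitsB S B H₁ H₂ y) (bitsB S B H₁ H₂ z))]
    exact sum_nonneg fun ρ _ => OneBlock.fB6_nonneg _ _ _ (adm _) (adm _) (adm _)
  -- identification: Σ fB = T − (c-terms)
  have eF : ∑ ρ : LPerm U, OneBlock.fB (bitsB S B H₁ H₂ (lpt ρ 0)) (bitsB S B H₁ H₂ (lpt ρ 1)) (bitsB S B H₁ H₂ (lpt ρ 2)) =
      T - (∑ ρ : LPerm U, OneBlock.m0010 (bitsB S B H₁ H₂ (lpt ρ 2)) * (ind (S ∪ B) (lpt ρ 0) * ind H₁ (lpt ρ 0))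
            - ∑ ρ : LPerm U, OneBlock.m0010 (bitsB S B H₁ H₂ (lpt ρ 2)) * (ind (S ∪ B) (lpt ρ 0) * ind H₁ (lpt ρ 1)))
        - (∑ ρ : LPerm U, OneBlock.m0010 (bitsB S B H₁ H₂ (lpt ρ 2)) * (ind (S ∪ B) (lpt ρ 0) * ind (H₁ ∪ H₂) (lpt ρ 0))
            - ∑ ρ : LPerm U, OneBlock.m0010 (bitsB S B H₁ H₂ (lpt ρ 2)) * (ind (S ∪ B) (lpt ρ 0) * ind (H₁ ∪ H₂) (lpt ρ 1)))
        - (∑ ρ : LPerm U, OneBlock.m1110 (bitsB S B H₁ H₂ (lpt ρ 2)) * (ind (S ∪ B) (lpt ρ 0) * ind (H₁ ∪ (S ∪ B) ∩ H₂) (lpt ρ 0))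
            - ∑ ρ : LPerm U, OneBlock.m1110 (bitsB S B H₁ H₂ (lpt ρ 2)) * (ind (S ∪ B) (lpt ρ 0) * ind (H₁ ∪ (S ∪ B) ∩ H₂) (lpt ρ 1)))
        - (∑ ρ : LPerm U, OneBlock.m1110 (bitsB S B H₁ H₂ (lpt ρ 2)) * (ind H₁ (lpt ρ 0) * ind ((S ∪ B) ∪ H₂) (lpt ρ 0))
            - ∑ ρ : LPerm U, OneBlock.m1110 (bitsB S B H₁ H₂ (lpt ρ 2)) * (ind H₁ (lpt ρ 0) * ind ((S ∪ B) ∪ H₂) (lpt ρ 1))) := by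
    rw [hT]
    simp only [← sum_sub_distrib]
    refine sum_congr rfl fun ρ _ => ?_
    simp only [OneBlock.fB, OneBlock.gB, OneBlock.chT, OneBlock.iSp, OneBlock.iH1, OneBlock.iH1H2, OneBlock.iH1SpH2, OneBlock.iSpH2,
      bitsB, ind_eq_bi, mem_union, mem_inter, Bool.decide_or, Bool.decide_and]
    ring
  have h6 : 0 ≤ ∑ ρ : LPerm U, OneBlock.fB (bitsB S B H₁ H₂ (lpt ρ 0)) (bitsB S B H₁ H₂ (lpt ρ 1)) (bitsB S B H₁ H₂ (lpt ρ 2)) := by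
    linarith
  rw [eF] at h6
  linarith

/-- **(Jγ) FOR EVERY BLOCK `U`**: for `S ∩ B = ∅`, `S ∪ B` an up-set, up-sets `H₁ ⊇ S`, `J_SO ⊇ S`, `J_OS`, and any `J_OO ⊆ J_SO ∩ J_OS`,
`4N(H₁;B) + 2N(J_OS;S) + 4N(J_OO;B) ≤ X|B| + 2X|S| + 3X|H₁∩B| + 4X|(J_SO∪J_OS)∩B| + 2X|J_SO∩B| + 6N(J_OS;B)`. [this work] -/
theorem oneBlock_gamma (hSB : Disjoint S B) (hS' : IsUpperSet ((S ∪ B : Finset (Pt U)) : Set (Pt U))) {H₁ JSO JOS JOO : Finset (Pt U)}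
    (u₁ : IsUpperSet (H₁ : Set (Pt U))) (uSO : IsUpperSet (JSO : Set (Pt U))) (uOS : IsUpperSet (JOS : Set (Pt U)))
    (hS : S ⊆ H₁) (hSO : S ⊆ JSO) (hOO₁ : JOO ⊆ JSO) (hOO₂ : JOO ⊆ JOS) :
    4 * nIn B H₁ + 2 * nIn S JOS + 4 * nIn B JOO ≤ 2 ^ Fintype.card U * B.card + 2 * 2 ^ Fintype.card U * S.card
      + 3 * 2 ^ Fintype.card U * (H₁ ∩ B).card + 4 * 2 ^ Fintype.card U * ((JSO ∪ JOS) ∩ B).card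
      + 2 * 2 ^ Fintype.card U * (JSO ∩ B).card + 6 * nIn B JOS := by
  -- replace `J_OO` by `J_SO ∩ J_OS`
  have hOO : nIn B JOO ≤ nIn B (JSO ∩ JOS) := by
    unfold nIn; exact sum_le_sum_of_subset_of_nonneg (subset_inter hOO₁ hOO₂) fun w _ _ => by positivity
  set T : ℤ := ∑ ρ : LPerm U, OneBlock.gG (bitsG S B H₁ JSO JOS (lpt ρ 0)) (bitsG S B H₁ JSO JOS (lpt ρ 1)) with hT
  have eT : T = 2 ^ Fintype.card U * B.card + 2 * 2 ^ Fintype.card U * S.card + 3 * 2 ^ Fintype.card U * (H₁ ∩ B).card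
      - 4 * nIn B H₁ + 4 * 2 ^ Fintype.card U * ((JSO ∪ JOS) ∩ B).card + 2 * 2 ^ Fintype.card U * (JSO ∩ B).card + 6 * nIn B JOS
      - 2 * nIn S JOS - 4 * nIn B (JSO ∩ JOS) := by
    have h : T = (∑ ρ : LPerm U, ind B (lpt ρ 1)) + 2 * (∑ ρ : LPerm U, ind S (lpt ρ 1))
        + 3 * (∑ ρ : LPerm U, ind H₁ (lpt ρ 1) * ind B (lpt ρ 1)) - 4 * (∑ ρ : LPerm U, ind H₁ (lpt ρ 0) * ind B (lpt ρ 1))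
        + 4 * (∑ ρ : LPerm U, ind (JSO ∪ JOS) (lpt ρ 1) * ind B (lpt ρ 1)) + 2 * (∑ ρ : LPerm U, ind JSO (lpt ρ 1) * ind B (lpt ρ 1))
        + 6 * (∑ ρ : LPerm U, ind JOS (lpt ρ 0) * ind B (lpt ρ 1)) - 2 * (∑ ρ : LPerm U, ind JOS (lpt ρ 0) * ind S (lpt ρ 1))
        - 4 * (∑ ρ : LPerm U, ind (JSO ∩ JOS) (lpt ρ 0) * ind B (lpt ρ 1)) := by
      rw [hT]
      simp only [mul_sum, ← sum_add_distrib, ← sum_sub_distrib]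
      exact sum_congr rfl fun ρ _ => by
        simp only [OneBlock.gG, bitsG, ind_eq_bi, mem_union, mem_inter, Bool.decide_or, Bool.decide_and, OneBlock.bi_and]
    rw [sum_lperm_ind_one, sum_lperm_ind_one, sum_lperm_ind_one_mul, sum_lperm_ind_zero_mul_one, sum_lperm_ind_one_mul,
      sum_lperm_ind_one_mul, sum_lperm_ind_zero_mul_one, sum_lperm_ind_zero_mul_one, sum_lperm_ind_zero_mul_one] at h
    rw [h]; ring
  have upSO : IsUpperSet ((H₁ ∪ JSO : Finset (Pt U)) : Set (Pt U)) := by rw [coe_union]; exact u₁.union uSO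
  have upOS : IsUpperSet ((H₁ ∪ JOS : Finset (Pt U)) : Set (Pt U)) := by rw [coe_union]; exact u₁.union uOS
  have upSpOS : IsUpperSet (((S ∪ B) ∪ JOS : Finset (Pt U)) : Set (Pt U)) := by rw [coe_union]; exact hS'.union uOS
  have hμ0 : ∀ z, 0 ≤ OneBlock.n00000 (bitsG S B H₁ JSO JOS z) := fun z => by unfold OneBlock.n00000 OneBlock.bi; split_ifs <;> norm_num
  have hμ1 : ∀ z, 0 ≤ OneBlock.n01000 (bitsG S B H₁ JSO JOS z) := fun z => by unfold OneBlock.n01000 OneBlock.bi; split_ifs <;> norm_num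
  have hμ2 : ∀ z, 0 ≤ OneBlock.n10110 (bitsG S B H₁ JSO JOS z) := fun z => by unfold OneBlock.n10110 OneBlock.bi; split_ifs <;> norm_num
  have hμ3 : ∀ z, 0 ≤ OneBlock.n00100 (bitsG S B H₁ JSO JOS z) := fun z => by unfold OneBlock.n00100 OneBlock.bi; split_ifs <;> norm_num
  have hμ4 : ∀ z, 0 ≤ OneBlock.n00110 (bitsG S B H₁ JSO JOS z) := fun z => by unfold OneBlock.n00110 OneBlock.bi; split_ifs <;> norm_num
  have hμ5 : ∀ z, 0 ≤ OneBlock.n00111 (bitsG S B H₁ JSO JOS z) := fun z => by unfold OneBlock.n00111 OneBlock.bi; split_ifs <;> norm_num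
  have hμ6 : ∀ z, 0 ≤ OneBlock.n01100 (bitsG S B H₁ JSO JOS z) := fun z => by unfold OneBlock.n01100 OneBlock.bi; split_ifs <;> norm_num
  have c1 := sum_lperm_condHarris hS' u₁ _ hμ0
  have c2 := sum_lperm_condHarris hS' u₁ _ hμ1
  have c3 := sum_lperm_condHarris hS' u₁ _ hμ2
  have c4 := sum_lperm_condHarris hS' upSO _ hμ3
  have c5 := sum_lperm_condHarris hS' upSO _ hμ4
  have c6 := sum_lperm_condHarris hS' upOS _ hμ3
  have c7 := sum_lperm_condHarris hS' upOS _ hμ4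
  have c8 := sum_lperm_condHarris hS' upOS _ hμ5
  have c9 := sum_lperm_condHarris upSpOS upOS _ hμ6
  have adm : ∀ x, OneBlock.admG (bitsG S B H₁ JSO JOS x) = true := by
    intro x
    by_cases hxS : x ∈ S
    · have hxB : x ∉ B := disjoint_left.1 hSB hxS
      have hx1 : x ∈ H₁ := hS hxS
      have hx2 : x ∈ JSO := hSO hxS
      simp [OneBlock.admG, bitsG, hxS, hxB, hx1, hx2]
    · simp [OneBlock.admG, bitsG, hxS]
  have key : 0 ≤ 6 * ∑ ρ : LPerm U, OneBlock.fG (bitsG S B H₁ JSO JOS (lpt ρ 0)) (bitsG S B H₁ JSO JOS (lpt ρ 1))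
      (bitsG S B H₁ JSO JOS (lpt ρ 2)) := by
    rw [six_mul_sum_lperm (fun x y z => OneBlock.fG (bitsG S B H₁ JSO JOS x) (bitsG S B H₁ JSO JOS y) (bitsG S B H₁ JSO JOS z))]
    exact sum_nonneg fun ρ _ => OneBlock.fG6_nonneg _ _ _ (adm _) (adm _) (adm _)
  have eF : ∑ ρ : LPerm U, OneBlock.fG (bitsG S B H₁ JSO JOS (lpt ρ 0)) (bitsG S B H₁ JSO JOS (lpt ρ 1)) (bitsG S B H₁ JSO JOS (lpt ρ 2)) =
      T - 2 * (∑ ρ : LPerm U, OneBlock.n00000 (bitsG S B H₁ JSO JOS (lpt ρ 2)) * (ind (S ∪ B) (lpt ρ 0) * ind H₁ (lpt ρ 0))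
              - ∑ ρ : LPerm U, OneBlock.n00000 (bitsG S B H₁ JSO JOS (lpt ρ 2)) * (ind (S ∪ B) (lpt ρ 0) * ind H₁ (lpt ρ 1)))
        - 2 * (∑ ρ : LPerm U, OneBlock.n01000 (bitsG S B H₁ JSO JOS (lpt ρ 2)) * (ind (S ∪ B) (lpt ρ 0) * ind H₁ (lpt ρ 0))
              - ∑ ρ : LPerm U, OneBlock.n01000 (bitsG S B H₁ JSO JOS (lpt ρ 2)) * (ind (S ∪ B) (lpt ρ 0) * ind H₁ (lpt ρ 1)))
        - 2 * (∑ ρ : LPerm U, OneBlock.n10110 (bitsG S B H₁ JSO JOS (lpt ρ 2)) * (ind (S ∪ B) (lpt ρ 0) * ind H₁ (lpt ρ 0))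
              - ∑ ρ : LPerm U, OneBlock.n10110 (bitsG S B H₁ JSO JOS (lpt ρ 2)) * (ind (S ∪ B) (lpt ρ 0) * ind H₁ (lpt ρ 1)))
        - 2 * (∑ ρ : LPerm U, OneBlock.n00100 (bitsG S B H₁ JSO JOS (lpt ρ 2)) * (ind (S ∪ B) (lpt ρ 0) * ind (H₁ ∪ JSO) (lpt ρ 0))
              - ∑ ρ : LPerm U, OneBlock.n00100 (bitsG S B H₁ JSO JOS (lpt ρ 2)) * (ind (S ∪ B) (lpt ρ 0) * ind (H₁ ∪ JSO) (lpt ρ 1)))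
        - 2 * (∑ ρ : LPerm U, OneBlock.n00110 (bitsG S B H₁ JSO JOS (lpt ρ 2)) * (ind (S ∪ B) (lpt ρ 0) * ind (H₁ ∪ JSO) (lpt ρ 0))
              - ∑ ρ : LPerm U, OneBlock.n00110 (bitsG S B H₁ JSO JOS (lpt ρ 2)) * (ind (S ∪ B) (lpt ρ 0) * ind (H₁ ∪ JSO) (lpt ρ 1)))
        - (∑ ρ : LPerm U, OneBlock.n00100 (bitsG S B H₁ JSO JOS (lpt ρ 2)) * (ind (S ∪ B) (lpt ρ 0) * ind (H₁ ∪ JOS) (lpt ρ 0))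
              - ∑ ρ : LPerm U, OneBlock.n00100 (bitsG S B H₁ JSO JOS (lpt ρ 2)) * (ind (S ∪ B) (lpt ρ 0) * ind (H₁ ∪ JOS) (lpt ρ 1)))
        - (∑ ρ : LPerm U, OneBlock.n00110 (bitsG S B H₁ JSO JOS (lpt ρ 2)) * (ind (S ∪ B) (lpt ρ 0) * ind (H₁ ∪ JOS) (lpt ρ 0))
              - ∑ ρ : LPerm U, OneBlock.n00110 (bitsG S B H₁ JSO JOS (lpt ρ 2)) * (ind (S ∪ B) (lpt ρ 0) * ind (H₁ ∪ JOS) (lpt ρ 1)))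
        - (∑ ρ : LPerm U, OneBlock.n00111 (bitsG S B H₁ JSO JOS (lpt ρ 2)) * (ind (S ∪ B) (lpt ρ 0) * ind (H₁ ∪ JOS) (lpt ρ 0))
              - ∑ ρ : LPerm U, OneBlock.n00111 (bitsG S B H₁ JSO JOS (lpt ρ 2)) * (ind (S ∪ B) (lpt ρ 0) * ind (H₁ ∪ JOS) (lpt ρ 1)))
        - 2 * (∑ ρ : LPerm U, OneBlock.n01100 (bitsG S B H₁ JSO JOS (lpt ρ 2)) * (ind ((S ∪ B) ∪ JOS) (lpt ρ 0) * ind (H₁ ∪ JOS) (lpt ρ 0))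
              - ∑ ρ : LPerm U, OneBlock.n01100 (bitsG S B H₁ JSO JOS (lpt ρ 2)) * (ind ((S ∪ B) ∪ JOS) (lpt ρ 0) * ind (H₁ ∪ JOS) (lpt ρ 1))) := by
    rw [hT]
    simp only [mul_sub, mul_sum, ← sum_sub_distrib]
    refine sum_congr rfl fun ρ _ => ?_
    simp only [OneBlock.fG, OneBlock.gG, OneBlock.chT, OneBlock.jSp, OneBlock.jH1, OneBlock.jH1SO, OneBlock.jH1OS, OneBlock.jSpOS,
      bitsG, ind_eq_bi, mem_union, Bool.decide_or]
    ring
  have h6 : 0 ≤ ∑ ρ : LPerm U, OneBlock.fG (bitsG S B H₁ JSO JOS (lpt ρ 0)) (bitsG S B H₁ JSO JOS (lpt ρ 1))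
      (bitsG S B H₁ JSO JOS (lpt ρ 2)) := by linarith
  rw [eF] at h6
  linarith

end oneblock

end Summit.CriticalPhenomena.PercolationContinuityZ3.Theorems.SahiLatin
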